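import Literature.Probability.FitznerVanDerHofstad2017.NoGoFrame

/-!
# Literature.Probability.FitznerVanDerHofstad2017.NoGoFrameScope — the class of constant tuples the no-go speaks about

CITATION HEADER (PLACEMENT v2). Part of the certified REPRODUCTION of R. Fitzner, R. van der Hofstad, *Mean-field
behavior for nearest-neighbor percolation in d > 10*, EJP 22 (2017) no. 43 [FvdH17] and *Generalized approach to the
non-backtracking lace expansion*, PTRF 169 (2017) 1041–1119 [NoBLE17]; build `lace`, seat lean1 (gen 5), REFEREE
C15(i) / REFEREE2 R9.  This module carries NO verdict and NO numerical literal; it is additive over `NoGoFrame`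
(no declaration of that module is changed).

THE POINT (REFEREE2 R9).  `NoGoFrame.Frame.Closes y` carries the two fields `1 < Γ₁`, `1 < Γ₂`, justified there by
[NoBLE17] Lemma 2.1 (Bootstrap argument), which is stated for `1 ≤ γ_i < Γ_i`.  The theorem of record, [NoBLE17]
Theorem 2.10 (Infrared bound), is however conditioned on `P(γ, Γ, z)` of Definition 2.9, whose printed standing
inequality is `0 ≤ γ_i < Γ_i` ((2.14)), together with `γ₁ ≥ max{f₁(z_I), …}` ((2.15)) and
`γ₂ ≥ ((2d−1)/(2d−2)) (c̄_Φ + β_{|α,Φ|} + β_{|R,Φ|})/(α̲_F − β̲_{ΔR,F})` ((2.16)); relative to Definition 2.9 as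
printed, `¬ ∃ y, Closes y` is therefore a statement about the tuples with `Γ₁ > 1 ∧ Γ₂ > 1` only.  This module
shows that the restriction in `Γ₂` is VOID: at every point whose App. D inputs are well formed, whose `μ̲` is at
most `z_I = 1/(2d−1)` and whose (2.16)-denominator is positive, the improved bound `boundF2` of cell 47 is `≥ 1`
(`Frame.one_le_F2`), so closing (`boundF2[s] < Γ₂`, cell 56) forces `Γ₂ > 1` (`Frame.ClosesP.one_lt_Gamma2`).  The
mechanism is the normalisation built into [NoBLE17]: the prefactor `(2d−1)/(2d−2)` of `f₂` ((2.2)) is exactly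
`2d z_I/(1 − z_I²)`, the value at `μ̲ = z_I` of the leading factor `2d μ̲/(1 − μ̲²)` of `α̲_F` ((D.3) lower,
`BetaMap.betaAfLow`), because `(2d−1)² − 1 = 2d(2d−2)`; with `c̄_Φ ≥ 1` ((D.2)) and `β_Δ ≥ 0` this gives
`boundF2 ≥ ((2d−1)/(2d−2))·1/((2d−1)/(2d−2)) = 1`.  (This is also why Lemma 2.1 may assume `γ₂ ≥ 1` without loss.)

WHAT IS PROVIDED.  `Frame.ClosesP` = `Frame.Closes` with the field `one_lt_Gamma2` removed (the class of Definition
2.9 in the coordinate `Γ₂`; the field `one_lt_Gamma1 : 1 < Γ₁` is KEPT — see SCOPE below); `Closes.toClosesP`,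
`ClosesP.toCloses`; the real-variable lemmas `afLowFactor_le`, `betaAfLow_le`; at frame level `afLow_le`,
`one_le_F2`, `ClosesP.den2_pos`, `ClosesP.one_lt_Gamma2`, `ClosesP.closes`; and the transfer
`noGoP_of_noGo : (signs at ClosesP points) → (¬ ∃ y, Closes y) → ¬ ∃ y, ClosesP y`, plus the in-cone form
`ClosesP.closes_of_floor` / `noGoP_of_noGo_floor` in which well-formedness comes from `Frame.Hyp` at a floor.

SCOPE THAT REMAINS (stated, not hidden).  (i) `1 < Γ₁` stays a field: `boundF1[part1,s] = (μ̄/μ)(1 + β_Π̂)/(1 − κ β_Ψ̂)`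
((3.5)) has `0 ≤ κ β_Ψ̂ < 1` and, in the typed instance, `μ̄/μ = 1/(1 − Bound[G,{1},3,s]) ≥ 1` (cell 10), hence is `≥ 1`
whenever `β_Π̂ ≥ 0` — but `β_Π̂ = 2d(·)Ξ^ι_even − Π̲` ((D.5), `BetaMap.betaPiHat`) carries no sign (the frame only
records `0 ≤ μ̄/μ` and `0 ≤ 1 + β_Π̂` at the floor), so `Γ₁ > 1` does not follow from the structural signs and remains
the standing hypothesis `1 ≤ γ₁ < Γ₁` of Lemma 2.1 (for percolation Definition 2.9 (2.15) gives `γ₁ ≥ f₁(z_I)`;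
whether that forces `γ₁ ≥ 1` is a property of the model's `μ̄_{z_I}`, not of this frame, and is not decided here).
(ii) The hypothesis `μ̲ ≤ z_I`: in the typed
instance `Stage1Cells.Data` (`Stage1Frame.lean`) `mumin[s] = z_I (1 − max(Bound[G,{1},3,s], Bound[G,{1},3,i]))`
(cell 44, `Data.muMin`), which is `≤ z_I` as soon as `Bound[G,{1},3,s] ≥ 0` (`Data.Std.g13_nonneg` in the cone above a
standard floor).  (iii) The typed instance's standing structure `Data.Std y₀` asks `1 ≤ Γ₂(y₀)` of the FLOOR (used in
`Data.Std.VAt_nonneg`, where `0 ≤ Γ₂(y₀)` would do, and in `Data.Std.val0_i_le_o`, to order the atom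
`VarGamma2[i] ≤ VarGamma2[o]`); instantiating `noGoP_of_noGo_floor` there for floors with `Γ₂(y₀) < 1` needs that
structure generalised first — this module is the frame-level half.

References: [NoBLE17] R. Fitzner, R. van der Hofstad, PTRF 169 (2017) 1041–1119, arXiv:1506.07969: Lemma 2.1 and
its proof (arXiv p. 10), (2.2) (definition of `f₂`), Definition 2.9 (2.14)–(2.16) and Theorem 2.10 (PTRF p. 1060),
App. D (D.2)–(D.3) (PTRF pp. 1110–1117); [FvdH17] notebook `Percolation.nb` cells 44, 47, 56 (transcript
`HOME/b2b-lace-num3/published/Percolation.txt` l.1214–1237, l.1303, l.1429–1444).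
-/

namespace Literature.Probability.FitznerVanDerHofstad2017
namespace NoGoFrame

open BetaMap

namespace Frame

/-! ## The real-variable core: `α̲_F ≤ (2d−1)/(2d−2)` when `μ̲ ≤ z_I` -/

section Real

/-- The leading factor of (D.3): `2d x/(1 − x²) ≤ (2d−1)/(2d−2)` for `0 ≤ x ≤ z_I = 1/(2d−1)`, `d > 1`; equality at
`x = z_I` since `(2d−1)² − 1 = 2d(2d−2)`.  (After clearing denominators this is `(t x − 1)(x + t) ≤ 0`, `t = 2d−1`.)
[cite: FitznerVanDerHofstad2016NoBLE, (2.2) and App. D (D.3), PTRF pp. 1110–1117] -/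
theorem afLowFactor_le {d x : ℝ} (hd : 1 < d) (hx0 : 0 ≤ x) (hx : x ≤ 1 / (2 * d - 1)) :
    2 * d * x / (1 - x ^ 2) ≤ (2 * d - 1) / (2 * d - 2) := by
  have ht : 0 < 2 * d - 1 := by linarith
  have htx : x * (2 * d - 1) ≤ 1 := (le_div_iff₀ ht).mp hx
  have hx1 : x < 1 := by nlinarith
  have hden : 0 < 1 - x ^ 2 := by nlinarith
  have hd2 : 0 < 2 * d - 2 := by linarith
  rw [div_le_div_iff₀ hden hd2]
  have key : 0 ≤ (1 - (2 * d - 1) * x) * (x + (2 * d - 1)) :=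
    mul_nonneg (by linarith) (by linarith)
  nlinarith [key]

/-- (D.3) lower: `α̲_F = (2d μ̲/(1 − μ̲²))·(1 − Ψ^{α,I} − μ Ψ^{α,II} − Π^α/(1 − μ²)) ≤ (2d−1)/(2d−2)` whenever
`0 ≤ μ̲ ≤ z_I`, `0 ≤ μ < 1` and the three subtracted inputs are `≥ 0` (the second factor is then `≤ 1`).
[cite: FitznerVanDerHofstad2016NoBLE, App. D (D.3), PTRF pp. 1110–1117] -/
theorem betaAfLow_le {d μm μ A B C : ℝ} (hd : 1 < d) (hμm0 : 0 ≤ μm) (hμm : μm ≤ 1 / (2 * d - 1))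
    (hμ0 : 0 ≤ μ) (hμ1 : μ < 1) (hA : 0 ≤ A) (hB : 0 ≤ B) (hC : 0 ≤ C) :
    betaAfLow d μm μ A B C ≤ (2 * d - 1) / (2 * d - 2) := by
  unfold betaAfLow
  have ht : 0 < 2 * d - 1 := by linarith
  have htx : μm * (2 * d - 1) ≤ 1 := (le_div_iff₀ ht).mp hμm
  have hμm1 : μm < 1 := by nlinarith
  have hfac : 0 ≤ 2 * d * μm / (1 - μm ^ 2) :=
    div_nonneg (by nlinarith) (by nlinarith)
  have hμ2 : 0 < 1 - μ ^ 2 := by nlinarith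
  have hC' : 0 ≤ 1 / (1 - μ ^ 2) * C := mul_nonneg (le_of_lt (one_div_pos.mpr hμ2)) hC
  have hsec : 1 - A - μ * B - 1 / (1 - μ ^ 2) * C ≤ 1 := by nlinarith [mul_nonneg hμ0 hB]
  calc 2 * d * μm / (1 - μm ^ 2) * (1 - A - μ * B - 1 / (1 - μ ^ 2) * C)
      ≤ 2 * d * μm / (1 - μm ^ 2) * 1 := mul_le_mul_of_nonneg_left hsec hfac
    _ = 2 * d * μm / (1 - μm ^ 2) := mul_one _
    _ ≤ (2 * d - 1) / (2 * d - 2) := afLowFactor_le hd hμm0 hμm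

end Real

/-! ## Frame level -/

section Defs

variable {ν : Type*} (Φ : Frame ν)

/-- CLOSING IN THE CLASS OF [NoBLE17] DEFINITION 2.9 (coordinate `Γ₂`): `Frame.Closes` with the field
`one_lt_Gamma2 : 1 < Γ₂` REMOVED — Definition 2.9 (2.14) asks only `0 ≤ γ₂ < Γ₂`, and `0 < Γ₂` already follows from
cell 56 (`0 < boundF2[s] < Γ₂`, fields `f2pos`, `f2`).  Every other field is verbatim that of `Frame.Closes`
(cells 45 ∧ 56 at both points, the App. D standing conditions, `m < 1`, `m > 0` from `c_μ > 0`, and the KEPT standing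
hypothesis `1 < Γ₁` of Lemma 2.1 — see the module docstring, SCOPE (i)).  `ClosesP.one_lt_Gamma2` shows the removed
field is a CONSEQUENCE of the others at points with well-formed inputs and `μ̲ ≤ z_I`.
[cite: FitznerVanDerHofstad2016NoBLE, Def. 2.9 (2.14)–(2.16) and Thm. 2.10, PTRF p. 1060; Lemma 2.1, arXiv p. 10] [cite: FitznerVanDerHofstad2017, notebook Percolation.nb cells 45, 55–56 (transcript l.1267–1270, 1429–1444)] -/
structure ClosesP (y : State) : Prop where
  stage1 : Φ.U y
  m_lt_one : y.m < 1
  /-- [NoBLE17] Lemma 2.1 is stated for `1 ≤ γ₁ < Γ₁`; KEPT (not derivable from the structural signs). -/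
  one_lt_Gamma1 : 1 < y.Gamma1
  m_pos : 0 < y.m
  muMin_nonneg : ∀ s, 0 ≤ ((Φ.S y).inp s).muMin
  tmp2_lt_one : ∀ s, Φ.tmp2At y s < 1
  kapPsi_lt_one : ∀ s, Φ.kap * (Φ.betaAt y s).βΨ < 1
  techI : ∀ s, 0 < Φ.techI y s
  techIII : ∀ s, Φ.techIII y s < 1
  f1part1 : ∀ s, Φ.part1 y s < y.Gamma1
  f1part2 : ∀ s, Φ.mlow y s < y.m
  f2pos : ∀ s, 0 < Φ.F2 y s
  f2 : ∀ s, Φ.F2 y s < y.Gamma2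
  f3init : ∀ j, Φ.initCell j < y.c j
  f3 : ∀ j, Φ.cellT y j < y.c j

end Defs

section Proofs

variable {ν : Type*} {Φ : Frame ν} {y₀ : State} {m₂ : ℝ}

/-- `Closes` is the sub-class `ClosesP ∧ 1 < Γ₂`: forgetting the field. [folklore] -/
theorem Closes.toClosesP {y : State} (hC : Φ.Closes y) : Φ.ClosesP y :=
  ⟨hC.stage1, hC.m_lt_one, hC.one_lt_Gamma1, hC.m_pos, hC.muMin_nonneg, hC.tmp2_lt_one, hC.kapPsi_lt_one,
    hC.techI, hC.techIII, hC.f1part1, hC.f1part2, hC.f2pos, hC.f2, hC.f3init, hC.f3⟩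

/-- … and restoring it. [folklore] -/
theorem ClosesP.toCloses {y : State} (hP : Φ.ClosesP y) (h : 1 < y.Gamma2) : Φ.Closes y :=
  ⟨hP.stage1, hP.m_lt_one, hP.one_lt_Gamma1, h, hP.m_pos, hP.muMin_nonneg, hP.tmp2_lt_one, hP.kapPsi_lt_one,
    hP.techI, hP.techIII, hP.f1part1, hP.f1part2, hP.f2pos, hP.f2, hP.f3init, hP.f3⟩

/-- A `ClosesP` point has `Γ₂ > 0` (cell 56: `0 < boundF2[s] < Γ₂`) — Definition 2.9 (2.14) in `Γ₂`, for free. [folklore] -/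
theorem ClosesP.Gamma2_pos {y : State} (hP : Φ.ClosesP y) : 0 < y.Gamma2 :=
  (hP.f2pos Pt.o).trans (hP.f2 Pt.o)

/-- (D.3) at frame level: `α̲_F(y, s) ≤ (2d−1)/(2d−2)` at a point whose inputs at `s` are well formed with
`μ̲ ≤ z_I = 1/(2d−1)`. [cite: FitznerVanDerHofstad2016NoBLE, App. D (D.3), PTRF pp. 1110–1117] -/
theorem afLow_le (hd : 1 < Φ.d) {y : State} {s : Pt} (W : ((Φ.S y).inp s).WF Φ.d)
    (hμ : ((Φ.S y).inp s).muMin ≤ 1 / (2 * Φ.d - 1)) :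
    (Φ.betaAt y s).αFlow ≤ (2 * Φ.d - 1) / (2 * Φ.d - 2) := by
  simp only [betaAt, nobleBetaOfInputs]
  exact betaAfLow_le hd W.muMin_nonneg hμ W.mu_nonneg W.mu_lt_one W.psiAlphaIOneMinusZeroAroundEi
    W.psiAlphaIIZeroMinusOneAroundZero W.piAlpha

/-- THE NORMALISATION OF `f₂`: cell 47 `boundF2[s] = ((2d−1)/(2d−2))·(c̄_Φ + β_{αΦ} + β_{RΦ})/(α̲_F − β_Δ) ≥ 1` at
every point whose inputs at `s` are well formed, with `μ̲ ≤ z_I` and positive denominator: the numerator is `≥ c̄_Φ ≥ 1`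
((D.2)), the denominator is `≤ α̲_F ≤ (2d−1)/(2d−2)` (`afLow_le`, `β_Δ ≥ 0`).
[cite: FitznerVanDerHofstad2016NoBLE, (2.2), (2.16) and App. D (D.2)–(D.3), PTRF pp. 1060, 1110–1117] [cite: FitznerVanDerHofstad2017, notebook Percolation.nb cell 47 (transcript l.1303)] -/
theorem one_le_F2 (hd : 2 ≤ Φ.d) {y : State} {s : Pt} (W : ((Φ.S y).inp s).WF Φ.d)
    (hμ : ((Φ.S y).inp s).muMin ≤ 1 / (2 * Φ.d - 1)) (hden : 0 < Φ.den2 y s) : 1 ≤ Φ.F2 y s := by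
  have hd1 : 1 ≤ Φ.d := by linarith
  have hr : 0 < (2 * Φ.d - 1) / (2 * Φ.d - 2) := div_pos (by linarith) (by linarith)
  have hN : 1 ≤ Φ.num2 y s := by
    have h1 := one_le_cPhiUp hd1 W
    have h2 := betaAlphaPhi_nonneg hd1 W
    have h3 := betaRPhi_nonneg hd1 W
    unfold num2
    linarith
  have hD : Φ.den2 y s ≤ (2 * Φ.d - 1) / (2 * Φ.d - 2) := by
    have h1 := afLow_le (by linarith) W hμ
    have h2 := deltaAt_nonneg hd1 W
    unfold den2
    linarith
  have key : Φ.den2 y s ≤ (2 * Φ.d - 1) / (2 * Φ.d - 2) * Φ.num2 y s :=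
    hD.trans (le_mul_of_one_le_right hr.le hN)
  unfold F2
  rw [← mul_div_assoc, one_le_div hden]
  exact key

/-- The (2.16)-denominator is positive at a `ClosesP` point with well-formed inputs: `0 < boundF2[s]` (cell 56) and
numerator `≥ c̄_Φ ≥ 1` force `α̲_F − β_Δ > 0` (as in `adm_of_closes`). [folklore] -/
theorem ClosesP.den2_pos (hd : 2 ≤ Φ.d) {y : State} (hP : Φ.ClosesP y) {s : Pt} (W : ((Φ.S y).inp s).WF Φ.d) :
    0 < Φ.den2 y s := by
  have hd1 : 1 ≤ Φ.d := by linarith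
  have hN : 0 < Φ.num2 y s := by
    have h1 := one_le_cPhiUp hd1 W
    have h2 := betaAlphaPhi_nonneg hd1 W
    have h3 := betaRPhi_nonneg hd1 W
    unfold num2; linarith
  have hκ : 0 < (2 * Φ.d - 1) / (2 * Φ.d - 2) := div_pos (by linarith) (by linarith)
  have hF := hP.f2pos s
  unfold F2 at hF
  have hq : 0 < Φ.num2 y s / Φ.den2 y s := by
    rcases le_or_gt (Φ.num2 y s / Φ.den2 y s) 0 with h | h
    · have := mul_nonpos_of_nonneg_of_nonpos hκ.le h
      linarith
    · exact h
  rcases div_pos_iff.mp hq with ⟨_, hD⟩ | ⟨hN', _⟩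
  · exact hD
  · linarith

/-- REFEREE C15(i): `Γ₂ > 1` DERIVED, not imported — a `ClosesP` point whose inputs at some `s` are well formed with
`μ̲ ≤ z_I` has `1 ≤ boundF2[s] < Γ₂`. [cite: FitznerVanDerHofstad2016NoBLE, Lemma 2.1 (arXiv p. 10), Def. 2.9 (2.14), (2.16), PTRF p. 1060] -/
theorem ClosesP.one_lt_Gamma2 (hd : 2 ≤ Φ.d) {y : State} (hP : Φ.ClosesP y) {s : Pt}
    (W : ((Φ.S y).inp s).WF Φ.d) (hμ : ((Φ.S y).inp s).muMin ≤ 1 / (2 * Φ.d - 1)) : 1 < y.Gamma2 :=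
  (one_le_F2 hd W hμ (hP.den2_pos hd W)).trans_lt (hP.f2 s)

/-- Hence such a `ClosesP` point closes in the sense of `Frame.Closes`. [folklore] -/
theorem ClosesP.closes (hd : 2 ≤ Φ.d) {y : State} (hP : Φ.ClosesP y) {s : Pt}
    (W : ((Φ.S y).inp s).WF Φ.d) (hμ : ((Φ.S y).inp s).muMin ≤ 1 / (2 * Φ.d - 1)) : Φ.Closes y :=
  hP.toCloses (hP.one_lt_Gamma2 hd W hμ)

/-- TRANSFER OF THE NO-GO TO DEFINITION 2.9's CLASS IN `Γ₂`: if every `ClosesP` point has, at some `s`, well-formed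
App. D inputs with `μ̲ ≤ z_I` (structural signs of stage 1 — in the typed instance, cells 3–43 on `U` at non-negative
coordinates), then `¬ ∃ y, Closes y` already excludes every tuple of the wider class. [folklore] -/
theorem noGoP_of_noGo (hd : 2 ≤ Φ.d)
    (hW : ∀ y, Φ.ClosesP y → ∃ s, ((Φ.S y).inp s).WF Φ.d ∧ ((Φ.S y).inp s).muMin ≤ 1 / (2 * Φ.d - 1))
    (hng : ¬ ∃ y, Φ.Closes y) : ¬ ∃ y, Φ.ClosesP y := by
  rintro ⟨y, hP⟩
  obtain ⟨s, W, hμ⟩ := hW y hP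
  exact hng ⟨y, hP.closes hd W hμ⟩

/-! ### In-cone form: well-formedness from `Frame.Hyp` at a floor -/

/-- A `ClosesP` point of the cone above a floor carrying `Frame.Hyp` is admissible on the box `m ≤ m₂` (verbatim the
argument of `adm_of_closes`, which never used `1 < Γ₂`). [folklore] -/
theorem ClosesP.adm (H : Φ.Hyp y₀) {y : State} (hy : y₀ ≤ y) (hP : Φ.ClosesP y) (hm : y.m ≤ m₂) :
    Φ.Adm m₂ y := by
  have hd1 := H.one_le_d
  have W : ∀ s, ((Φ.S y).inp s).WF Φ.d := fun s =>
    { toNonneg := (H.nonneg hy hP.stage1).inp s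
      mu_nonneg := by rw [H.mu_eq hy s]; exact H.m_floor.trans hy.2.1
      mu_lt_one := by rw [H.mu_eq hy s]; exact hP.m_lt_one
      muMin_nonneg := hP.muMin_nonneg s
      tmp2_lt_one := hP.tmp2_lt_one s }
  exact ⟨hP.stage1, hP.m_lt_one, hm, hP.muMin_nonneg, hP.tmp2_lt_one, hP.kapPsi_lt_one,
    fun s => hP.den2_pos H.two_le_d (W s), hP.techI⟩

/-- In the cone above a floor carrying `Frame.Hyp`, a `ClosesP` point with `μ̲(y, s) ≤ z_I` at some `s` has `Γ₂ > 1`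
(REFEREE C15(i)'s `one_lt_Gamma2_of_floor`, with the floor supplying well-formedness rather than a number). [folklore] -/
theorem ClosesP.one_lt_Gamma2_of_floor (H : Φ.Hyp y₀) {y : State} (hy : y₀ ≤ y) (hP : Φ.ClosesP y) {s : Pt}
    (hμ : ((Φ.S y).inp s).muMin ≤ 1 / (2 * Φ.d - 1)) : 1 < y.Gamma2 :=
  hP.one_lt_Gamma2 H.two_le_d (wf_of_adm H hy (hP.adm H hy le_rfl) s) hμ

/-- … and therefore closes in the sense of `Frame.Closes`. [folklore] -/
theorem ClosesP.closes_of_floor (H : Φ.Hyp y₀) {y : State} (hy : y₀ ≤ y) (hP : Φ.ClosesP y) {s : Pt}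
    (hμ : ((Φ.S y).inp s).muMin ≤ 1 / (2 * Φ.d - 1)) : Φ.Closes y :=
  hP.toCloses (hP.one_lt_Gamma2_of_floor H hy hμ)

/-- THE NO-GO ON DEFINITION 2.9's CLASS, in-cone form: given a floor `y₀` below every `ClosesP` point, carrying
`Frame.Hyp`, and `μ̲ ≤ z_I` at the `ClosesP` points of its cone, the no-go for `Closes` is the no-go for `ClosesP`.
(Floor dominance for `ClosesP`: `Γ₁ > 1`, `m > 0`, `Γ₂ > 0` (`ClosesP.Gamma2_pos`), `c_j > boundF3[j,i]`; so any
`y₀ ≤ (1, 0, 0, initCell)` qualifies.) [folklore] -/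
theorem noGoP_of_noGo_floor (H : Φ.Hyp y₀) (hdom : ∀ y, Φ.ClosesP y → y₀ ≤ y)
    (hμ : ∀ y, Φ.ClosesP y → ∃ s, ((Φ.S y).inp s).muMin ≤ 1 / (2 * Φ.d - 1))
    (hng : ¬ ∃ y, Φ.Closes y) : ¬ ∃ y, Φ.ClosesP y := by
  rintro ⟨y, hP⟩
  obtain ⟨s, hs⟩ := hμ y hP
  exact hng ⟨y, hP.closes_of_floor H (hdom y hP) hs⟩

/-- Floor dominance for `ClosesP` at the floor `(1, 0, 0, c₀)`, `c₀ ≤ initCell`. [folklore] -/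
theorem ClosesP.floor_le {y : State} (hP : Φ.ClosesP y) {c₀ : Fin 6 → ℝ} (hc : ∀ j, c₀ j ≤ Φ.initCell j) :
    ({ Gamma1 := 1, m := 0, Gamma2 := 0, c := c₀ } : State) ≤ y :=
  ⟨hP.one_lt_Gamma1.le, hP.m_pos.le, hP.Gamma2_pos.le, fun j => (hc j).trans (hP.f3init j).le⟩

end Proofs

end Frame

end NoGoFrame
end Literature.Probability.FitznerVanDerHofstad2017
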